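/-
Origin: written from primary sources — S. Kudla, *Seesaw dual reductive pairs* (1984) §1 (the see-saw identity, extended by bilinearity
to spans of theta series); A. Borel, N. Wallach, *Continuous cohomology, discrete subgroups, and representations of reductive groups*
(2000) VII §3. Adapted: no. Elementary bilinear algebra (Mathlib `Submodule.map₂_span_span`) over the tree's `Weil1964.wedgeFun` and
`ThetaKernelDatum.thetaKer`; kernel only, no records.
-/
import Literature.NumberTheory.Weil1964.ThetaFormWedgePeriod
import Mathlib.Algebra.Module.Submodule.Bilinear
import HarnessLib

/-!
# The wedge of forms in SPANS of theta forms is still one torus period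

`Weil1964/ThetaFormWedgePeriod` shows that the wedge `wedgeFun ℓ₁ ℓ₂ F₁ F₂` of two single theta FORMS is the see-saw torus period
of ONE big test function.  Theta-form SPACES are SPANS of theta forms (tree `ThetaKernelDatum.thetaForms`, and the PKG's
`thetaOf = thetaClasses ιinf D (thetaForms 𝓙 𝓕)`), so the consumer needs the identity for arbitrary elements of two spans.  This
file supplies the bilinear bookkeeping:

* §1 `wedgeFun` is BILINEAR in `(F₁, F₂)` — packaged as `wedgeFunₗ ℓ₁ ℓ₂ : (X → W) →ₗ[ℂ] (X → W) →ₗ[ℂ] (X → ℂ)`;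
* §2 **`wedgeFun_mem_of_span`** — for any submodule `T` of functions (model case: the image `S.map P` of a submodule `S` of big test
  functions under a LINEAR period map `P`): if `wedgeFun ℓ₁ ℓ₂ F G ∈ T` for all generators `F ∈ A`, `G ∈ B`, then the same holds for
  all `F ∈ span A`, `G ∈ span B` (`Submodule.map₂_span_span`); unpacked form **`exists_wedgeFun_eq_of_span`**:
  `(∀ F ∈ A, ∀ G ∈ B, ∃ Ψ ∈ S, F ∧ G = P Ψ) → ∀ F ∈ span A, ∀ G ∈ span B, ∃ Ψ ∈ S, F ∧ G = P Ψ`;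
* §3 the see-saw torus period IS linear in the big test function: **`seesawPeriodₗ`** `: SX →ₗ[ℂ] (GU → ℂ)`,
  `Ψ ↦ (g ↦ ∫_{[U₁]×[U₂]} θ_Ψ(g⁻¹ ΓU, bd(q₁,q₂)) f₁(q₁) f₂(q₂))`, under the datum's `ThetaLinear` hypothesis (`thetaKer_add/_smul`) and
  `[OpensMeasurableSpace ((U₁ ⧸ Γ₁) × (U₂ ⧸ Γ₂))]` (e.g. one factor second countable) for integrability of the continuous integrands
  (`seesawPeriodₗ_apply`).

With §3 as `P` and `S := 𝒮^κ` (a submodule), §2 turns the generator-level statement of `ThetaFormWedgePeriod` /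
`GelbartRogawski1991/UnitaryDualPairSeesawThetaPeriod` into `Gen12FunBridge.wf_gen`'s «`∃ χ Φ, wf = ϑ χ Φ`» for ALL pairs of classes.
Provenance / use: Hodge-CM model-construction cell, rows `gen12`/`real34`.  Nothing here is a claim of the manuscripts under
adjudication.
-/

set_option autoImplicit false

noncomputable section

open _root_.MeasureTheory Function Module
open Literature.MeasureTheory.Integral Literature.NumberTheory.Automorphic

namespace Literature.NumberTheory.Weil1964

/-! ## §1 Bilinearity of the wedge function -/

section Bilinear

variable {X : Type*} {W : Type*} [AddCommGroup W] [Module ℂ W] (ℓ₁ ℓ₂ : Dual ℂ W)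

/-- additivity in the first function. [folklore] -/
theorem wedgeFun_add_left (F₁ F₁' F₂ : X → W) :
    wedgeFun ℓ₁ ℓ₂ (F₁ + F₁') F₂ = wedgeFun ℓ₁ ℓ₂ F₁ F₂ + wedgeFun ℓ₁ ℓ₂ F₁' F₂ := by
  funext x; simp only [wedgeFun_apply, Pi.add_apply, map_add]; ring

/-- homogeneity in the first function. [folklore] -/
theorem wedgeFun_smul_left (a : ℂ) (F₁ F₂ : X → W) :
    wedgeFun ℓ₁ ℓ₂ (a • F₁) F₂ = a • wedgeFun ℓ₁ ℓ₂ F₁ F₂ := by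
  funext x; simp only [wedgeFun_apply, Pi.smul_apply, map_smul, smul_eq_mul]; ring

/-- additivity in the second function. [folklore] -/
theorem wedgeFun_add_right (F₁ F₂ F₂' : X → W) :
    wedgeFun ℓ₁ ℓ₂ F₁ (F₂ + F₂') = wedgeFun ℓ₁ ℓ₂ F₁ F₂ + wedgeFun ℓ₁ ℓ₂ F₁ F₂' := by
  funext x; simp only [wedgeFun_apply, Pi.add_apply, map_add]; ring

/-- homogeneity in the second function. [folklore] -/
theorem wedgeFun_smul_right (a : ℂ) (F₁ F₂ : X → W) :
    wedgeFun ℓ₁ ℓ₂ F₁ (a • F₂) = a • wedgeFun ℓ₁ ℓ₂ F₁ F₂ := by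
  funext x; simp only [wedgeFun_apply, Pi.smul_apply, map_smul, smul_eq_mul]; ring

/-- **the wedge as a BILINEAR map** `(X → W) →ₗ (X → W) →ₗ (X → ℂ)`. [folklore] -/
def wedgeFunₗ : (X → W) →ₗ[ℂ] (X → W) →ₗ[ℂ] (X → ℂ) :=
  LinearMap.mk₂ ℂ (wedgeFun ℓ₁ ℓ₂) (wedgeFun_add_left ℓ₁ ℓ₂) (wedgeFun_smul_left ℓ₁ ℓ₂) (wedgeFun_add_right ℓ₁ ℓ₂)
    (wedgeFun_smul_right ℓ₁ ℓ₂)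

/-- `wedgeFunₗ` IS `wedgeFun`. [folklore] -/
@[simp] theorem wedgeFunₗ_apply (F₁ F₂ : X → W) : wedgeFunₗ ℓ₁ ℓ₂ F₁ F₂ = wedgeFun ℓ₁ ℓ₂ F₁ F₂ := rfl

/-! ## §2 Span closure -/

/-- **closure under spans**: if the wedges of all pairs of generators lie in a submodule `T` of functions, so do the wedges of
all pairs from the spans. [folklore] -/
theorem wedgeFun_mem_of_span {A B : Set (X → W)} {T : Submodule ℂ (X → ℂ)}
    (h : ∀ F ∈ A, ∀ G ∈ B, wedgeFun ℓ₁ ℓ₂ F G ∈ T) {F G : X → W} (hF : F ∈ Submodule.span ℂ A)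
    (hG : G ∈ Submodule.span ℂ B) : wedgeFun ℓ₁ ℓ₂ F G ∈ T := by
  have hle : Submodule.map₂ (wedgeFunₗ ℓ₁ ℓ₂) (Submodule.span ℂ A) (Submodule.span ℂ B) ≤ T := by
    rw [Submodule.map₂_span_span, Submodule.span_le]
    rintro _ ⟨F', hF', G', hG', rfl⟩
    exact h F' hF' G' hG'
  exact hle (Submodule.apply_mem_map₂ (wedgeFunₗ ℓ₁ ℓ₂) hF hG)

/-- **unpacked form**: with `T := S.map P` for a submodule `S` of big test functions and a LINEAR period map `P` —
«every pair of generators has its wedge equal to a period `P Ψ`, `Ψ ∈ S`» propagates to all pairs in the spans.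
[cite: Kudla1984, §1] -/
theorem exists_wedgeFun_eq_of_span {SX : Type*} [AddCommGroup SX] [Module ℂ SX] (P : SX →ₗ[ℂ] (X → ℂ))
    (S : Submodule ℂ SX) {A B : Set (X → W)}
    (h : ∀ F ∈ A, ∀ G ∈ B, ∃ Ψ ∈ S, wedgeFun ℓ₁ ℓ₂ F G = P Ψ) {F G : X → W} (hF : F ∈ Submodule.span ℂ A)
    (hG : G ∈ Submodule.span ℂ B) : ∃ Ψ ∈ S, wedgeFun ℓ₁ ℓ₂ F G = P Ψ := by
  have h' : ∀ F ∈ A, ∀ G ∈ B, wedgeFun ℓ₁ ℓ₂ F G ∈ S.map P := fun F hF G hG => by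
    obtain ⟨Ψ, hΨ, hEq⟩ := h F hF G hG
    exact ⟨Ψ, hΨ, hEq.symm⟩
  obtain ⟨Ψ, hΨ, hEq⟩ := wedgeFun_mem_of_span ℓ₁ ℓ₂ h' hF hG
  exact ⟨Ψ, hΨ, hEq.symm⟩

end Bilinear

/-! ## §3 The see-saw torus period is linear in the big test function -/

namespace ThetaKernelDatum

universe u v

section Period

variable {Mp : Type u} {SX : Type v} [TopologicalSpace Mp] [Group Mp] [TopologicalSpace SX]
variable {GU : Type*} [Group GU] [TopologicalSpace GU] [IsTopologicalGroup GU] {ΓU : Subgroup GU}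
variable {G : Type*} [Group G] [TopologicalSpace G] [IsTopologicalGroup G] {Γ : Subgroup G}
variable {U₁ : Type*} [Group U₁] [TopologicalSpace U₁] {Γ₁ : Subgroup U₁}
variable {U₂ : Type*} [Group U₂] [TopologicalSpace U₂] {Γ₂ : Subgroup U₂}
variable (M : ThetaKernelDatum Mp SX GU ΓU G Γ)
variable {bd : U₁ × U₂ →* G} (hbd : ∀ γ₁ ∈ Γ₁, ∀ γ₂ ∈ Γ₂, bd (γ₁, γ₂) ∈ Γ)
variable [MeasurableSpace (U₁ ⧸ Γ₁)] (μ₁ : Measure (U₁ ⧸ Γ₁)) [MeasurableSpace (U₂ ⧸ Γ₂)] (μ₂ : Measure (U₂ ⧸ Γ₂))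

/-- the see-saw torus period of the big kernel of `Ψ` against `f₁ ⊠ f₂`, read on the group:
`g ↦ ∫_{[U₁]×[U₂]} θ_Ψ(g⁻¹ ΓU, bd(q₁,q₂)) f₁(q₁) f₂(q₂) d(μ₁ ⊗ μ₂)`. [cite: Kudla1984, §1] -/
def seesawPeriod (f₁ : C(U₁ ⧸ Γ₁, ℂ)) (f₂ : C(U₂ ⧸ Γ₂, ℂ)) (Ψ : SX) : GU → ℂ := fun g =>
  ∫ q : (U₁ ⧸ Γ₁) × (U₂ ⧸ Γ₂), M.thetaKer Ψ (QuotientGroup.mk g⁻¹, seesawQuot bd hbd q) * (f₁ q.1 * f₂ q.2) ∂(μ₁.prod μ₂)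

/-- unfolding. [folklore] -/
theorem seesawPeriod_apply (f₁ : C(U₁ ⧸ Γ₁, ℂ)) (f₂ : C(U₂ ⧸ Γ₂, ℂ)) (Ψ : SX) (g : GU) :
    M.seesawPeriod hbd μ₁ μ₂ f₁ f₂ Ψ g =
      ∫ q : (U₁ ⧸ Γ₁) × (U₂ ⧸ Γ₂), M.thetaKer Ψ (QuotientGroup.mk g⁻¹, seesawQuot bd hbd q) * (f₁ q.1 * f₂ q.2)
        ∂(μ₁.prod μ₂) :=
  rfl

variable [IsTopologicalGroup U₁] [IsTopologicalGroup U₂] (hc : Continuous bd)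
  [CompactSpace (U₁ ⧸ Γ₁)] [CompactSpace (U₂ ⧸ Γ₂)] [OpensMeasurableSpace ((U₁ ⧸ Γ₁) × (U₂ ⧸ Γ₂))]
  [IsFiniteMeasure μ₁] [IsFiniteMeasure μ₂]

include hc in
/-- the integrand of the period is integrable (continuous on a compact space, finite measure). [folklore] -/
theorem integrable_seesawPeriod_integrand (f₁ : C(U₁ ⧸ Γ₁, ℂ)) (f₂ : C(U₂ ⧸ Γ₂, ℂ)) (Ψ : SX) (g : GU) :
    Integrable (fun q : (U₁ ⧸ Γ₁) × (U₂ ⧸ Γ₂) =>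
      M.thetaKer Ψ (QuotientGroup.mk g⁻¹, seesawQuot bd hbd q) * (f₁ q.1 * f₂ q.2)) (μ₁.prod μ₂) := by
  refine Continuous.integrable_of_hasCompactSupport ?_ (HasCompactSupport.of_compactSpace _)
  exact ((M.thetaKer Ψ).continuous.comp (continuous_const.prodMk (continuous_seesawQuot bd hbd hc))).mul
    ((f₁.continuous.comp continuous_fst).mul (f₂.continuous.comp continuous_snd))

variable [AddCommGroup SX] [Module ℂ SX] (hlin : M.W.ThetaLinear)

include hlin hc in
/-- **the see-saw torus period is LINEAR in the big test function** (`θ_{Ψ+Ψ'} = θ_Ψ + θ_{Ψ'}`, `θ_{aΨ} = a θ_Ψ` under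
`ThetaLinear`). [folklore] -/
def seesawPeriodₗ (f₁ : C(U₁ ⧸ Γ₁, ℂ)) (f₂ : C(U₂ ⧸ Γ₂, ℂ)) : SX →ₗ[ℂ] (GU → ℂ) where
  toFun := M.seesawPeriod hbd μ₁ μ₂ f₁ f₂
  map_add' Ψ Ψ' := by
    funext g
    simp only [Pi.add_apply, seesawPeriod_apply, M.thetaKer_add hlin, ContinuousMap.add_apply, add_mul]
    exact integral_add (M.integrable_seesawPeriod_integrand hbd μ₁ μ₂ hc f₁ f₂ Ψ g)
      (M.integrable_seesawPeriod_integrand hbd μ₁ μ₂ hc f₁ f₂ Ψ' g)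
  map_smul' a Ψ := by
    funext g
    simp only [RingHom.id_apply, Pi.smul_apply, seesawPeriod_apply, M.thetaKer_smul hlin, ContinuousMap.smul_apply,
      smul_eq_mul, mul_assoc]
    exact integral_const_mul a _

/-- `seesawPeriodₗ` IS `seesawPeriod`. [folklore] -/
@[simp] theorem seesawPeriodₗ_apply (f₁ : C(U₁ ⧸ Γ₁, ℂ)) (f₂ : C(U₂ ⧸ Γ₂, ℂ)) (Ψ : SX) :
    M.seesawPeriodₗ hbd μ₁ μ₂ hc hlin f₁ f₂ Ψ = M.seesawPeriod hbd μ₁ μ₂ f₁ f₂ Ψ := rfl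

end Period

end ThetaKernelDatum

end Literature.NumberTheory.Weil1964

end
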